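import Mathlib
import Summits.Ventures.PercRepro.TriangleCapBelowThreshold
import Summits.Ventures.PercRepro.TriangleCapStarPlusFour

/-!
# PercRepro — THE CELL `(7, 10) = 25` OF THE `K₄⁻`-FREE CHERRY TABLE, AND THE ROW TWO BELOW THE THRESHOLD FOR EVERY `t ≥ 4`
(p3, gen 32; part 17 — the last cell of the row `m = k + 3` the count reaches)

Two below the threshold at `t = 4` is the single cell `(k, m) = (7, 10)`, where the census reads `25 = K_{2,5}`
(`bipPend 7 4`, no pendant edge).  TriangleCapBelowThreshold's count has no room there: at a vertex of maximum
degree `4` with every off-degree `≤ 3` the bound `Y ≥ 2m′(m′ − 5) = 12` falls short of the needed `Y ≥ 2T + 8 = 16`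
when `T = 4`, and at maximum degree `5` the defect sum seen from a vertex of off-degree `5` is `0`.  ONE
structural lemma closes both: **`outDeg_add_outDeg_add_deg_le_of_T`** — for a matching pair `x ~ y` inside `N(v)`
the off-neighbours of `x` are `y` and the vertices of `R = V ∖ (N(v) ∪ {v})` adjacent to `x`, likewise for `y`,
and no vertex of `R` is adjacent to both (it would be a second common neighbour of the adjacent pair `x, y`, with
`v`; `K₄⁻`), so `outDeg x + outDeg y + d(v) ≤ k + 1` and (TriangleCapOutDeg's per-pair bound) every matching
pair is avoided by at least `m′ + d(v) − k` edges off `v`.  Summed — **`sum_avoid_ge_of_T_of_outDeg_le`**: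
`T(m′ + d − k) + (|R| − T)(m′ + 1 − 2b) ≤ Y` with every off-degree `≤ b` — this gives `Y ≥ 3T` at maximum degree
`5` and `Y ≥ 2T + 12` at maximum degree `4` (off-degrees `≤ 3`), and **`cherries_le_twenty_five_of_k4mFree`** /
**`seven_ten_exact`** follow.  With TriangleCapOneBelow and TriangleCapBelowThreshold the row two below the
threshold is then exact for EVERY `t ≥ 4` (**`row_two_below_exact`**), and the row `m = k + 3` is a theorem for
every `k ≥ 7`.  Axioms: standard.
-/

namespace PercRepro

namespace TriangleCap

namespace C047

open Finset

variable {V : Type*} [Fintype V] [DecidableEq V]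

/-- **A matching pair has at most `|R| + 2` off-neighbours in total:** for `p = (x, y)` off `v` with `x, y ∈ N(v)`,
`outDeg x + outDeg y + d(v) ≤ k + 1` — the off-neighbours of `x` are `y` and the vertices of
`R = V ∖ (N(v) ∪ {v})` adjacent to `x`, likewise for `y`, and no vertex of `R` is adjacent to both (`K₄⁻`). -/
theorem outDeg_add_outDeg_add_deg_le_of_T (D : SimpleGraph V) [DecidableRel D.Adj] (hK : K4mFree D)
    {v : V} {p : V × V} (hp : p ∈ offPairs D v) (h1 : D.Adj v p.1) (h2 : D.Adj v p.2) :
    outDeg D v p.1 + outDeg D v p.2 + deg D v ≤ Fintype.card V + 1 := by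
  rw [mem_offPairs] at hp
  obtain ⟨hxy, -, -⟩ := hp
  set R := (univ.filter (fun x => ¬ D.Adj v x)).erase v with hRdef
  -- the off-neighbours of a matched neighbour `c` with partner `c'`: `c'` or a vertex of `R` adjacent to `c`
  have key : ∀ c c' : V, D.Adj v c → D.Adj v c' → D.Adj c c' →
      ((offPairs D v).filter (fun q => q.1 = c)).image Prod.snd ⊆
        insert c' (R.filter (fun x => D.Adj c x)) := by
    intro c c' hvc hvc' hcc' x hx
    rw [mem_image] at hx
    obtain ⟨q, hq, rfl⟩ := hx
    rw [mem_filter, mem_offPairs] at hq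
    obtain ⟨⟨hadj, -, hq2⟩, hqc⟩ := hq
    rw [hqc] at hadj
    rw [mem_insert]
    by_cases hvx : D.Adj v q.2
    · left
      by_contra hne
      have hle := card_filter_adj_neighbors_le_one D hK hvc
      have hmem1 : q.2 ∈ (univ.filter (fun x => D.Adj v x)).filter (fun x => D.Adj c x) :=
        mem_filter.mpr ⟨mem_filter.mpr ⟨mem_univ _, hvx⟩, hadj⟩
      have hmem2 : c' ∈ (univ.filter (fun x => D.Adj v x)).filter (fun x => D.Adj c x) :=
        mem_filter.mpr ⟨mem_filter.mpr ⟨mem_univ _, hvc'⟩, hcc'⟩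
      have hsub := card_le_card (insert_subset hmem1 (singleton_subset_iff.mpr hmem2))
      rw [card_insert_of_notMem (by simpa using hne), card_singleton] at hsub
      omega
    · right
      rw [mem_filter, hRdef, mem_erase, mem_filter]
      exact ⟨⟨hq2, mem_univ _, hvx⟩, hadj⟩
  have hinj : ∀ c : V, Set.InjOn Prod.snd
      (((offPairs D v).filter (fun q => q.1 = c) : Finset (V × V)) : Set (V × V)) := by
    intro c q hq q' hq' he
    rw [mem_coe, mem_filter] at hq hq'
    exact Prod.ext (hq.2.trans hq'.2.symm) he
  -- no vertex of `R` is adjacent to both `p.1` and `p.2`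
  have hdisj : Disjoint (R.filter (fun x => D.Adj p.1 x)) (R.filter (fun x => D.Adj p.2 x)) := by
    rw [disjoint_left]
    intro r hr1 hr2
    rw [mem_filter, hRdef, mem_erase, mem_filter] at hr1 hr2
    have hle := card_inter_le_one_of_adj D hK hxy
    have hmem1 : r ∈ (univ.filter (fun x => D.Adj p.1 x)) ∩ (univ.filter (fun x => D.Adj p.2 x)) :=
      mem_inter.mpr ⟨mem_filter.mpr ⟨mem_univ _, hr1.2⟩, mem_filter.mpr ⟨mem_univ _, hr2.2⟩⟩
    have hmem2 : v ∈ (univ.filter (fun x => D.Adj p.1 x)) ∩ (univ.filter (fun x => D.Adj p.2 x)) :=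
      mem_inter.mpr ⟨mem_filter.mpr ⟨mem_univ _, h1.symm⟩, mem_filter.mpr ⟨mem_univ _, h2.symm⟩⟩
    have hne : r ≠ v := hr1.1.1
    have hsub := card_le_card (insert_subset hmem1 (singleton_subset_iff.mpr hmem2))
    rw [card_insert_of_notMem (by simpa using hne), card_singleton] at hsub
    omega
  have hR : R.card + 1 + deg D v = Fintype.card V := by
    have hvmem : v ∈ univ.filter (fun x => ¬ D.Adj v x) := mem_filter.mpr ⟨mem_univ _, D.irrefl⟩
    rw [hRdef, card_erase_add_one hvmem]
    have := card_filter_add_card_filter_not (s := (univ : Finset V)) (fun x => D.Adj v x)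
    rw [card_univ] at this
    unfold deg
    omega
  have hu : (R.filter (fun x => D.Adj p.1 x)).card + (R.filter (fun x => D.Adj p.2 x)).card ≤ R.card := by
    have h := card_union_add_card_inter (R.filter (fun x => D.Adj p.1 x)) (R.filter (fun x => D.Adj p.2 x))
    rw [disjoint_iff_inter_eq_empty.mp hdisj, card_empty] at h
    have h' : (R.filter (fun x => D.Adj p.1 x) ∪ R.filter (fun x => D.Adj p.2 x)).card ≤ R.card :=
      card_le_card (union_subset (filter_subset _ _) (filter_subset _ _))
    omega
  have e1 := card_le_card (key p.1 p.2 h1 h2 hxy)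
  have e2 := card_le_card (key p.2 p.1 h2 h1 hxy.symm)
  rw [card_image_of_injOn (hinj p.1)] at e1
  rw [card_image_of_injOn (hinj p.2)] at e2
  have c1 := card_insert_le p.2 (R.filter (fun x => D.Adj p.1 x))
  have c2 := card_insert_le p.1 (R.filter (fun x => D.Adj p.2 x))
  unfold outDeg
  omega

/-- A matching pair is avoided by at least `m′ + d(v) − k` edges off `v`. -/
theorem card_offEdges_add_deg_le_card_avoid_add_card_of_T (D : SimpleGraph V) [DecidableRel D.Adj]
    (hK : K4mFree D) {v : V} {p : V × V} (hp : p ∈ offPairs D v) (h1 : D.Adj v p.1) (h2 : D.Adj v p.2) :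
    (offEdges D v).card + deg D v ≤ (avoid D v p).card + Fintype.card V := by
  have ha := card_offEdges_add_one_le D v hp
  have hb := outDeg_add_outDeg_add_deg_le_of_T D hK hp h1 h2
  omega

/-- **The defect sum split into the matching pairs and the rest:** with every off-degree `≤ b`,
`T · (m′ + d − k) + (|R| − T) · (m′ + 1 − 2b) ≤ Y`. -/
theorem sum_avoid_ge_of_T_of_outDeg_le (D : SimpleGraph V) [DecidableRel D.Adj] (hK : K4mFree D) (v : V)
    (b : ℕ) (hb : ∀ u, outDeg D v u ≤ b) :
    ((offPairs D v).filter (fun p => D.Adj v p.1 ∧ D.Adj v p.2)).card *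
        ((offEdges D v).card + deg D v - Fintype.card V) +
      ((offPairs D v).card - ((offPairs D v).filter (fun p => D.Adj v p.1 ∧ D.Adj v p.2)).card) *
        ((offEdges D v).card + 1 - 2 * b) ≤
      ∑ p ∈ offPairs D v, (avoid D v p).card := by
  have hs := sum_filter_add_sum_filter_not (offPairs D v) (fun p => D.Adj v p.1 ∧ D.Adj v p.2)
    (fun p => (avoid D v p).card)
  have h1 := card_nsmul_le_sum ((offPairs D v).filter (fun p => D.Adj v p.1 ∧ D.Adj v p.2))
    (fun p => (avoid D v p).card) ((offEdges D v).card + deg D v - Fintype.card V) (fun p hp => by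
      rw [mem_filter] at hp
      have := card_offEdges_add_deg_le_card_avoid_add_card_of_T D hK hp.1 hp.2.1 hp.2.2
      omega)
  have h2 := card_nsmul_le_sum ((offPairs D v).filter (fun p => ¬ (D.Adj v p.1 ∧ D.Adj v p.2)))
    (fun p => (avoid D v p).card) ((offEdges D v).card + 1 - 2 * b) (fun p hp => by
      rw [mem_filter] at hp
      have := card_offEdges_add_one_le D v hp.1
      have := hb p.1
      have := hb p.2
      omega)
  have hc := card_filter_add_card_filter_not (s := offPairs D v) (fun p => D.Adj v p.1 ∧ D.Adj v p.2)
  rw [smul_eq_mul] at h1 h2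
  have e : (offPairs D v).card - ((offPairs D v).filter (fun p => D.Adj v p.1 ∧ D.Adj v p.2)).card =
      ((offPairs D v).filter (fun p => ¬ (D.Adj v p.1 ∧ D.Adj v p.2))).card := by omega
  rw [e]
  omega

/-- **THE CELL `(7, 10)`, THE BOUND:** every `K₄⁻`-free graph with `10` edges on `7` vertices has
`Σ_v C(d(v), 2) ≤ 25`. -/
theorem cherries_le_twenty_five_of_k4mFree (D : SimpleGraph V) [DecidableRel D.Adj] (hK : K4mFree D)
    (hk : Fintype.card V = 7) (hm : D.edgeFinset.card = 10) : cherries D ≤ 25 := by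
  by_cases hdeg : ∀ v, deg D v ≤ 3
  · -- every degree `≤ 3`: `2·cherries ≤ 2 Σ d = 4m = 40`
    have h2 : 2 * cherries D ≤ (3 - 1) * ∑ v, deg D v := by
      unfold cherries
      rw [mul_sum, mul_sum]
      exact sum_le_sum (fun v _ => two_mul_choose_two_le_pred_mul _ _ (hdeg v))
    rw [sum_deg_eq, hm] at h2
    omega
  · push Not at hdeg
    obtain ⟨u, hu⟩ := hdeg
    -- a vertex of maximum degree, of degree `≥ 4`
    obtain ⟨v, -, hmax⟩ := exists_max_image univ (deg D) ⟨u, mem_univ u⟩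
    have hmax' : ∀ w, deg D w ≤ deg D v := fun w => hmax w (mem_univ w)
    have hv : 4 ≤ deg D v := by
      have := hmax' u
      omega
    -- the split of `2 Σ d²` (TriangleCapDiagonal) and the counts at `v`
    have hS := sum_adjPairsAll_deg_add D
    have hsplit1 := sum_filter_add_sum_filter_not (adjPairsAll D) (fun p => p.1 = v)
      (fun p => deg D p.1 + deg D p.2)
    have hsplit2 := sum_filter_add_sum_filter_not ((adjPairsAll D).filter (fun p => ¬ p.1 = v))
      (fun p => p.2 = v) (fun p => deg D p.1 + deg D p.2)
    rw [filter_not_fst_filter_snd, filter_not_fst_filter_not_snd] at hsplit2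
    have hfst := sum_filter_fst_deg_add D v
    have hsnd := sum_filter_snd_deg_add D v
    have hA := sum_deg_neighbors_eq D v
    have hE := two_mul_card_E_le D v
    have hT := card_T_le_deg D hK v
    have hRc := two_mul_card_edges_eq D v
    have hR1 := sum_R_add_sum_avoid_le D v
    have hc := two_mul_cherries_add D
    rw [sum_deg_eq] at hc
    have hdk : deg D v + 1 ≤ Fintype.card V := by
      have hsub : univ.filter (fun w => D.Adj v w) ⊆ univ.erase v := by
        intro w hw
        rw [mem_filter] at hw
        rw [mem_erase]
        exact ⟨(D.ne_of_adj hw.2).symm, mem_univ _⟩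
      have h1 : deg D v ≤ (univ.erase v).card := card_le_card hsub
      rw [card_erase_of_mem (mem_univ v), card_univ] at h1
      have h2 : 1 ≤ Fintype.card V := Fintype.card_pos_iff.mpr ⟨v⟩
      omega
    -- the combined linear bound with the defect sum
    have hmain : 2 * (∑ x, deg D x * deg D x) + (offPairs D v).card * deg D v +
        ∑ p ∈ offPairs D v, (avoid D v p).card ≤
        2 * (deg D v * deg D v) + 2 * deg D v +
          4 * ((offPairs D v).filter (fun p => D.Adj v p.1)).card +
          (offPairs D v).card * D.edgeFinset.card + (offPairs D v).card := by
      linarith [hS, hsplit1, hsplit2, hfst, hsnd, hA, hR1]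
    -- the structural facts, instantiated
    have hdom : deg D v + 1 = Fintype.card V →
        ((offPairs D v).filter (fun p => D.Adj v p.1 ∧ D.Adj v p.2)).card = (offPairs D v).card :=
      fun h => congrArg card (filter_T_eq_offPairs_of_deg_add_one_eq_card D h)
    have hEc := card_offEdges D v
    -- a vertex `c` of maximum off-degree
    obtain ⟨c, -, hcmax⟩ := exists_max_image univ (outDeg D v) ⟨v, mem_univ v⟩
    have hcmax' : ∀ w, outDeg D v w ≤ outDeg D v c := fun w => hcmax w (mem_univ w)
    have hδd : outDeg D v c ≤ deg D v := (outDeg_le_deg D v c).trans (hmax' c)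
    have hδ1 := sum_avoid_ge_of_outDeg D v c
    -- the defect sum split into the matching pairs and the rest, with every off-degree `≤ δ`
    have hL := sum_avoid_ge_of_T_of_outDeg_le D hK v (outDeg D v c) hcmax'
    -- names for the quantities
    set T := ((offPairs D v).filter (fun p => D.Adj v p.1 ∧ D.Adj v p.2)).card with hTdef
    set E := ((offPairs D v).filter (fun p => D.Adj v p.1)).card with hEdef
    set Rc := (offPairs D v).card with hRcdef
    set Y := ∑ p ∈ offPairs D v, (avoid D v p).card with hYdef
    set Ec := (offEdges D v).card with hEcdef
    set δ := outDeg D v c with hδdef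
    set d := deg D v with hddef
    set m := D.edgeFinset.card with hmdef
    set k := Fintype.card V with hkdef
    set ch := cherries D with hchdef
    set s2 := ∑ x, deg D x * deg D x with hs2def
    clear_value T E Rc Y Ec δ d m k ch s2
    have hfin : 2 * s2 + Rc * d + Y ≤ 2 * (d * d) + 2 * d + 2 * Rc + 2 * T + Rc * m + Rc := by
      linarith [hmain, hE]
    clear hmain hS hsplit1 hsplit2 hfst hsnd hA hR1 hE hTdef hEdef hRcdef hYdef hEcdef hδdef hddef
      hmdef hkdef hchdef hs2def hmax hmax' hcmax hcmax' hu
    subst hk hm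
    -- `d ∈ {4, 5, 6}`
    obtain ⟨a, rfl⟩ : ∃ a, d = 4 + a := ⟨d - 4, by omega⟩
    rcases (by omega : a = 0 ∨ a = 1 ∨ a = 2) with rfl | rfl | rfl
    · -- maximum degree `4`: `|R| = 12`, `m′ = 6`; `Y ≥ 2T + 8`
      have hRc' : Rc = 12 := by omega
      have hEc' : Ec = 6 := by omega
      subst hRc' hEc'
      have hY : 2 * T + 8 ≤ Y := by
        by_cases hδ4 : 4 ≤ δ
        · have hδ' : δ = 4 := by omega
          subst hδ'
          omega
        · -- every off-degree `≤ 3`: the matching pairs give `3T`, the rest `≥ 1` each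
          have h1 : (12 - T) * 1 ≤ (12 - T) * (6 + 1 - 2 * δ) := Nat.mul_le_mul_left _ (by omega)
          omega
      omega
    · -- maximum degree `5`: `|R| = 10`, `m′ = 5`; the matching pairs are avoided by `≥ 3` edges each
      have hRc' : Rc = 10 := by omega
      have hEc' : Ec = 5 := by omega
      subst hRc' hEc'
      have h0 := Nat.zero_le ((10 - T) * (5 + 1 - 2 * δ))
      omega
    · -- maximum degree `6` (dominating): `T = |R| = 8 > 6`, impossible
      have hT2 := hdom (by omega)
      omega

/-- **THE CELL `(7, 10) = 25`, EXACT:** every `K₄⁻`-free graph with `10` edges on `7` vertices has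
`Σ_v C(d(v), 2) ≤ 25`, and `K_{2,5}` (`bipPend 7 4`) attains it. -/
theorem seven_ten_exact :
    (∀ (D : SimpleGraph (Fin 7)) [DecidableRel D.Adj], K4mFree D → D.edgeFinset.card = 10 →
        cherries D ≤ 25) ∧
      ∃ (D : SimpleGraph (Fin 7)) (_ : DecidableRel D.Adj),
        K4mFree D ∧ D.edgeFinset.card = 10 ∧ cherries D = 25 := by
  refine ⟨fun D _ hK hD => cherries_le_twenty_five_of_k4mFree D hK (by simp) hD,
    bipPend 7 4, inferInstance, k4mFree_bipPend 7 4, ?_, ?_⟩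
  · have := card_edges_bipPend 7 4 (by norm_num)
    omega
  · rw [cherries_bipPend 7 4 (by norm_num)]
    decide

/-- **THE ROW TWO BELOW THE THRESHOLD, THE BOUND, FOR EVERY `t ≥ 4`:** for `t ≥ 4` and `t² + 6 ≤ 2k + t + 4` every
`K₄⁻`-free graph with `k − 1 + t` edges on `k` vertices has `Σ_v C(d(v), 2) ≤ C(k − 1, 2) + 2t + 2`. -/
theorem cherries_le_star_value_add_two_of_k4mFree (t : ℕ) (ht : 4 ≤ t) (D : SimpleGraph V)
    [DecidableRel D.Adj] (hK : K4mFree D) (hk : t * t + 6 ≤ 2 * Fintype.card V + t + 4)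
    (hm : D.edgeFinset.card + 1 = Fintype.card V + t) :
    cherries D ≤ (Fintype.card V - 1).choose 2 + 2 * t + 2 := by
  rcases (by omega : t = 4 ∨ 5 ≤ t) with rfl | h5
  · -- `t = 4`: `k ≥ 7`; `k ≥ 8` is one below or above, `k = 7` is the cell
    rcases (by omega : Fintype.card V = 7 ∨ 8 ≤ Fintype.card V) with h7 | h8
    · have := cherries_le_twenty_five_of_k4mFree D hK h7 (by omega)
      rw [h7]
      have e : (7 - 1).choose 2 + 2 * 4 + 2 = 25 := by decide
      omega
    · have := cherries_le_star_value_add_one_of_k4mFree 4 (by norm_num) D hK (by omega) hm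
      omega
  · have := cherries_le_star_value_add_of_k4mFree t 2 h5 (by norm_num) D hK (by omega) hm
    exact this

/-- **THE ROW TWO BELOW THE THRESHOLD, EXACT, FOR EVERY `t ≥ 4`:** at `2k + t + 4 = t² + 6` the `K₄⁻`-free cherry
maximum at `(k, k − 1 + t)` is exactly `C(k − 1, 2) + 2t + 2`, attained by `K_{2,t+1}` plus `k − t − 3` pendant
edges (`K_{2,5}` itself at `t = 4`). -/
theorem row_two_below_exact (t k : ℕ) (ht : 4 ≤ t) (hk : 2 * k + t + 4 = t * t + 6) :
    (∀ (D : SimpleGraph (Fin k)) [DecidableRel D.Adj], K4mFree D → D.edgeFinset.card + 1 = k + t →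
        cherries D ≤ (k - 1).choose 2 + 2 * t + 2) ∧
      ∃ (D : SimpleGraph (Fin k)) (_ : DecidableRel D.Adj),
        K4mFree D ∧ D.edgeFinset.card + 1 = k + t ∧ cherries D = (k - 1).choose 2 + 2 * t + 2 := by
  refine ⟨fun D _ hK hD => ?_, ?_⟩
  · have hk' : t * t + 6 ≤ 2 * Fintype.card (Fin k) + t + 4 := by
      rw [Fintype.card_fin]
      omega
    have := cherries_le_star_value_add_two_of_k4mFree t ht D hK hk' (by rw [hD]; simp)
    simpa using this
  · rcases (by omega : t = 4 ∨ 5 ≤ t) with rfl | h5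
    · have h7 : k = 7 := by omega
      subst h7
      obtain ⟨-, D, inst, hK, hD, hc⟩ := seven_ten_exact
      exact ⟨D, inst, hK, by omega, by rw [hc]; decide⟩
    · exact exists_k4mFree_cherries_eq_star_add k t 2 h5 (by norm_num) hk

/-- The row `m = k + 3` of the table, every cell from `k = 7` on: `25` at `k = 7`, `30` at `k = 8`, and the star
value `C(k − 1, 2) + 8` for `k ≥ 9`. -/
theorem row_plus_three_from_seven (k : ℕ) (hk : 7 ≤ k) :
    (∀ (D : SimpleGraph (Fin k)) [DecidableRel D.Adj], K4mFree D → D.edgeFinset.card = k + 3 →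
        cherries D ≤ (k - 1).choose 2 + 8 + (if k = 7 then 2 else if k = 8 then 1 else 0)) ∧
      ∃ (D : SimpleGraph (Fin k)) (_ : DecidableRel D.Adj), K4mFree D ∧ D.edgeFinset.card = k + 3 ∧
        cherries D = (k - 1).choose 2 + 8 + (if k = 7 then 2 else if k = 8 then 1 else 0) := by
  rcases (by omega : k = 7 ∨ k = 8 ∨ 9 ≤ k) with rfl | rfl | h9
  · obtain ⟨h1, D, inst, hK, hD, hc⟩ := seven_ten_exact
    have e : (7 - 1).choose 2 = 15 := by decide
    refine ⟨fun D _ hK hD => ?_, D, inst, hK, hD, ?_⟩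
    · have := h1 D hK hD
      simp only [if_true]
      omega
    · simp only [if_true]
      omega
  · obtain ⟨h1, D, inst, hK, hD, hc⟩ := eight_eleven_exact
    have e : (8 - 1).choose 2 = 21 := by decide
    refine ⟨fun D _ hK hD => ?_, D, inst, hK, hD, ?_⟩
    · have := h1 D hK hD
      simp only [show (8 : ℕ) ≠ 7 from by decide, if_false, if_true]
      omega
    · simp only [show (8 : ℕ) ≠ 7 from by decide, if_false, if_true]
      omega
  · obtain ⟨h1, h2⟩ := row_plus_three_exact k h9
    rw [if_neg (by omega), if_neg (by omega)]
    exact ⟨fun D _ hK hD => by simpa using h1 D hK hD, by simpa using h2⟩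

end C047

end TriangleCap

end PercRepro
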